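import Summits.Langlands.Langlands.Theses.E8QuinticResidue
import HarnessLib

/-!
# `E8QuinticResidue.E8Alpha5Grading` (stmt-Langlands-8670) — proved by kernel decision

[proof of `Summit.Langlands.Langlands.Theses.E8QuinticResidue.E8Alpha5Grading`
(route `E8QuinticResidue`, support item, rank 9; the card's item P1)]

**Statement.**  In the Bourbaki model of `E₈` with doubled (integral) coordinates — the root set
`Φ ⊆ ℤ⁸` is the union of the vectors in `{−2,0,2}⁸` with `Σ|bᵢ| = 4` (the `112` roots
`±eᵢ ± eⱼ`, doubled) and the vectors in `{−1,1}⁸` with `Π bᵢ = 1` (the `128` roots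
`½(±1,…,±1)` with an even number of minus signs, doubled) — one has `#Φ = 240`, and the
`α₅`-degree `b ↦ b₃ + b₄ + b₅ + b₆ + 4b₇` (pairing with the doubled fundamental coweight
`ϖ₅ = e₄ + e₅ + e₆ + e₇ + 4e₈`, indices shifted to `Fin 8`) takes the doubled values
`0, 2, 4, 6, 8, 10` on exactly `32, 40, 30, 20, 10, 4` roots (Levi `A₄ + A₃` with `32` roots;
`dim 𝔲 = 40 + 30 + 20 + 10 + 4 = 104`; Richardson orbit of dimension `248 − 40 = 208 = dim E₈(a₇)`).

**Proof.**  After substituting the defining equation of `Φ` the statement is a closed conjunction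
of seven cardinalities of explicit filtered finsets of functions `Fin 8 → ℤ`
(`Fintype.piFinset`, computable), decided by the kernel (`decide +kernel`; `3⁸ + 2⁸ = 6817`
candidate vectors).  No `native_decide`, no named fact; axioms `propext`, `Classical.choice`,
`Quot.sound` only. -/

set_option linter.dupNamespace false

namespace Summit.Langlands.Langlands.Theorems.E8QuinticResidueE8Alpha5Grading

open Summit.Langlands.Langlands.Theses.E8QuinticResidue

/-- **stmt-Langlands-8670** `E8QuinticResidue.E8Alpha5Grading`: `240` roots of `E₈` in the doubled
Bourbaki model, graded `32 / 40 / 30 / 20 / 10 / 4` by the (doubled) `α₅`-degree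
`b₃ + b₄ + b₅ + b₆ + 4b₇ ∈ {0, 2, 4, 6, 8, 10}` — decided by the kernel. -/
theorem e8Alpha5Grading : E8Alpha5Grading := by
  intro Φ hΦ
  subst hΦ
  decide +kernel

end Summit.Langlands.Langlands.Theorems.E8QuinticResidueE8Alpha5Grading
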